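import Summits.BirchSwinnertonDyer.Rank1Residual.Additive.RamifiedSevenGenusPushedTwistedUnit
import Summits.BirchSwinnertonDyer.Rank1Residual.Additive.RamifiedSevenGenusStickelbergerReading
import Summits.BirchSwinnertonDyer.Rank1Residual.Additive.RamifiedSevenGenusTwistedUnitIdentity
import Summits.BirchSwinnertonDyer.Rank1Residual.Additive.RamifiedSevenGenusChiLogarithmCalculus
import HarnessLib

set_option autoImplicit false

/-!
# `𝒞₇` genus road (crux `EllipticUnitValueSevenOfGZK`, K7r), the (5)-unit programme (SUMMON GENUS-UNIT-A6), File E4: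
# THE IDENTITY UP TO A `Λ`-UNIT ON THE PIN — ★★★ `unitSideIdentityShapeUpToUnit_of_pin` and ★★★★
# `genusUnitSideInputsSeven_of_facts` (the K1ᵘ input stub's letter, CONDITIONAL on F5 = `Kato2004.kato1551_kroneckerLimitFormula`)

Cell bsd-cm, seat bsd-cm-k-ty1 g27 (literature-prover); SUMMON `wake/SUMMON-bsd-cm-k-ty1-20260830T2140Z.md` (planner g36,
D972) block (A6-3) = File E, LAST brick: the module-side assembly on Tsuji's pinned `𝓤 = F.U`.

* §2 ★ `GenusFrame.rep_two_smul_theta_add_smul_xi_eq_one` — THE LEVEL-`n` KERNEL STATEMENT: from (A6-2)'s core identity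
  `wₙ·c(wₙ) = 1` (`wₙ = θₙ²·∏ᶠ_h (h ξₙ)^{y h}`) for a transport `(σ, T)` at `ζsys n` and a complex conjugation `c` (`c ζsys n = ζsys n⁻¹`),
  for every genus datum `d`: `rep n (2•e_{η₁}θ + Pₙ•e_{η₁}ξ) = 1`, `Pₙ = Σ_g C(Y g)·R_n(ḡ)` — lift the `σ_g` and `c` into
  `Υ·γ₀^ℕ` (E1 `exists_towerLift`), push and kill (E4a `rep_pushedTwistedUnit_eq_one`), apply `e_{η₁}` (E2 `rep_chiProjector_eq_one`,
  E4a `apply_pushedElement_eq`; `η₁(υ_c) = 1`, `(1+T)^{r_n(mₙ−1)} ≡ 1 (mod h_n)`), divide by the unit `96`;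
  `GenusFrame.reading_torsor_eq` (the torsor's reading `χ_D(b̄ₙ)ω(b̄ₙ)⁵` is level-independent, `torsor_val_modEq`).
* §3 ★★★ `unitSideIdentityShapeUpToUnit_of_pin (hF5) (F) (hθu) : UnitSideIdentityShapeUpToUnit F θu`: with (A6-2)'s `Φ, c, b, W, σ, T`
  (`c₀ = 1`), E3b at every level (`Pₙ·R_n(b̄ₙ) ≡ x·Θm`), `R_n(b̄ₙ) ≡ C(χ_D(b̄₀)ω(b̄₀)⁵)·W =: W′` (level-independence of the torsor's
  reading, `torsor_val_modEq`), hence `rep n (2•θ + (W′⁻¹·x·Θm)•ξ) = 1` for all `n`, (I) `eq_zero_of_rep_eq_one`, and `2 ∈ ℤ₇ˣ`: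
  `e_{η₁}θ^𝔞 = (c₀·W′⁻¹·x·Θm)•e_{η₁}ξ`, `c₀ = −½` — i.e. `d.UnitFactorisationShape` (`unitFactorisationShape_iff_exists_unit`).
* §4 ★★★★ `genusUnitSideInputsSeven_of_facts (hF5) (hT) (h25) (h24i)` : the K1ᵘ input stub's letter (zp v15 l.528–535 verbatim) —
  `genusUnitSideInputsSevenUpToUnit_of_identity hT h25 h24i` fed with ★★★.

HONEST LABEL: CONDITIONAL on F5 (`kato1551_kroneckerLimitFormula`, first binder) and on the three cited facts of the other
conjuncts (Tsuji L6.2 (a), de Shalit II.2.5 (i), II.2.4 (i)); no definition, no named fact, no instance; the crux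
stmt-BirchSwinnertonDyer-19945 stays OPEN until the pen's touch (T1) replaces the stub by these theorems and the remaining stubs
(K2ᶜ, hR3c, PR^×) are discharged; `X12.CMRamifiedSeven` NOT proved; no summit statement is proved by this seat; BSD is claimed for
no curve.

## References
* K. Kato, Astérisque 295 (2004) §15.5 (15.5.1), §15.6 (pp. 253–254) [Kato2004Asterisque]; T. Tsuji, J. Number Theory 78 (1999)
  §2 Lemma 2.1, §3 (pp. 3–6), §6 (p. 20) [Tsuji1999]; S. Lang, *Cyclotomic Fields I–II* (1990) Ch. 1 §2, Ch. 5 §1, Ch. 10 §1–§2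
  (PDF pp. 14–16, 115–116, 167–172) [Lang1990]; L. Washington, *Introduction to Cyclotomic Fields* (1997) §6.2, §7.2, §8.3
  [Washington1997]; E. de Shalit (1987) II.2.4–II.2.5, II.5.1 [deShalit1987]; K. Rubin, Invent. Math. 103 (1991) §4 [Rubin1991].
* Tree: (A6-1) `RamifiedSevenGenusStickelbergerDictionary`, (A6-2) `RamifiedSevenGenusTwistedUnitIdentity`, E1 `…TowerLifts`, E2
  `…SemilocalKernel`, E3a `…EtaOneReading`, E3b `…StickelbergerReading`, E4a `…PushedTwistedUnit` (this seat); `RamifiedSevenGenusUnitSideUpToUnit`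
  (`UnitSideIdentityShapeUpToUnit`, `genusUnitSideInputsSevenUpToUnit_of_identity`), `RamifiedSevenGenusChiLogarithmCalculus`
  (`torsor_val_modEq`).
-/

noncomputable section

open scoped NumberField ComplexConjugate NumberTheorySymbols
open PowerSeries IsDedekindDomain Field
open Literature.NumberTheory.EllipticCurves
open Literature.NumberTheory.EllipticCurves.IwasawaAlgebra
open Literature.NumberTheory.IwasawaTheory
open Literature.NumberTheory.IwasawaTheory.StickelbergerSeries
open Literature.NumberTheory.IwasawaTheory.CyclotomicUnits (sinnottNorm)
open Literature.NumberTheory.QuadraticFields (jacobiChar jacobiChar_natCast)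
open Literature.NumberTheory.ComplexMultiplication.EllipticUnits
open Literature.NumberTheory.NumberFields
open Literature.NumberTheory.GaloisRepresentations
open Summit.BirchSwinnertonDyer.BirchSwinnertonDyer.Theorems.PrintCf2.LeopoldtAtV
  (galUnits_mem_globalUnitsOf galTranslate_globalToSemilocalUnits)

namespace Summit.BirchSwinnertonDyer.Rank1Residual.Additive.GenusSeven

/-! ## §2 The level-`n` kernel statement -/

namespace GenusFrame

variable (F : GenusFrame)

/-- ★ **THE LEVEL-`n` KERNEL STATEMENT.**  For a genus datum `d` over `(F, θu)`, a transport `(σ, T)` at `ζsys n` (`σ_g ζ = ζ^{ḡ}`,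
`T g = σ_g|_{F′ₙ}`), a complex conjugation `c` (`c ζsys n = ζsys n⁻¹`), integer exponents `Y` and the CORE IDENTITY of (A6-2)
`wₙ·c(wₙ) = 1`, `wₙ = θₙ²·∏ᶠ_h (h ξₙ)^{Σ_{T g = h} Y g}`: `rep n (2•e_{η₁}θ + (Σ_g C(Y g)·R_n(ḡ))•e_{η₁}ξ) = 1` on Tsuji's `𝓤`.
Proof: lift the `σ_g` and `c` into `Υ·γ₀^ℕ` (E1), push (`rep_pushedTwistedUnit_eq_one`), apply `e_{η₁}` (E2
`rep_chiProjector_eq_one`, `apply_pushedElement_eq`; `η₁(υ_c) = 1`, `(1+T)^{r_n(mₙ−1)} ≡ 1`), divide by `96 ∈ ℤ₇ˣ`.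
[cite: Tsuji1999, §2 Lemma 2.1, §3 (pp. 3–6), §6 (p. 20)] [cite: Kato2004Asterisque, §15.5 (15.5.1) (p. 253)] [cite: Lang1990, Ch. 10 §1–§2 (PDF pp. 167–171)] -/
theorem rep_two_smul_theta_add_smul_xi_eq_one {θu : ∀ n : ℕ, globalUnitsOf (F.layer n)} (d : GenusDatum F θu) (n : ℕ)
    [NeZero (7 ^ (n + 1) * F.d)] {c : AlgebraicClosure ℚ ≃ₐ[ℚ] AlgebraicClosure ℚ} (hcζ : c (F.ζsys n) = (F.ζsys n)⁻¹)
    (σ : (ZMod (7 ^ (n + 1) * F.d))ˣ → (AlgebraicClosure ℚ ≃ₐ[ℚ] AlgebraicClosure ℚ))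
    (T : (ZMod (7 ^ (n + 1) * F.d))ˣ →* (F.layer n ≃ₐ[ℚ] F.layer n))
    (hσ : ∀ g : (ZMod (7 ^ (n + 1) * F.d))ˣ, σ g (F.ζsys n) = F.ζsys n ^ ((g : ZMod (7 ^ (n + 1) * F.d))).val)
    (hT : ∀ (g : (ZMod (7 ^ (n + 1) * F.d))ˣ) (x : F.layer n), ((T g x : F.layer n) : AlgebraicClosure ℚ) = σ g x)
    (Y : (ZMod (7 ^ (n + 1) * F.d))ˣ → ℤ)
    (hcore : ((((toFieldUnits (F.layer n) (θu n) : (F.layer n : Type)ˣ) : F.layer n) ^ 2 *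
            ∏ᶠ h : F.layer n ≃ₐ[ℚ] F.layer n,
              (h ((toFieldUnits (F.layer n) (d.ξu n) : (F.layer n : Type)ˣ) : F.layer n)) ^
              (∑ᶠ (g : (ZMod (7 ^ (n + 1) * F.d))ˣ) (_ : T g = h), Y g) : F.layer n) : AlgebraicClosure ℚ) *
        c ((((toFieldUnits (F.layer n) (θu n) : (F.layer n : Type)ˣ) : F.layer n) ^ 2 *
            ∏ᶠ h : F.layer n ≃ₐ[ℚ] F.layer n,
              (h ((toFieldUnits (F.layer n) (d.ξu n) : (F.layer n : Type)ˣ) : F.layer n)) ^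
              (∑ᶠ (g : (ZMod (7 ^ (n + 1) * F.d))ˣ) (_ : T g = h), Y g) : F.layer n) : AlgebraicClosure ℚ) = 1)
    (R : ℕ → IwasawaAlgebra 7)
    (hR : ∀ a : ℕ, R a = C (F.χD (a : ZMod F.d) * F.ω (a : ZMod 7) ^ 5) * (1 + X) ^ F.r n a) :
    F.U.rep n ((2 : IwasawaAlgebra 7) • (d.θ : F.U.M) +
      (∑ g : (ZMod (7 ^ (n + 1) * F.d))ˣ, C (((Y g : ℤ) : ℤ_[7])) * R ((g : ZMod (7 ^ (n + 1) * F.d))).val) •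
        (d.ξ : F.U.M)) = 1 := by
  haveI : Fact (Nat.Prime 7) := ⟨Nat.prime_seven⟩
  have he := d.e_isChiProjector
  -- Step A: E1's lifts of the `σ_g` and of `c`
  have hlift : ∀ g : (ZMod (7 ^ (n + 1) * F.d))ˣ, ∃ υ : torsionCyclotomicSubgroup 7,
      ((F.η₁ υ : ℤ_[7]ˣ) : ℤ_[7]) =
          F.χD ((((g : ZMod (7 ^ (n + 1) * F.d))).val : ℕ) : ZMod F.d) *
            F.ω ((((g : ZMod (7 ^ (n + 1) * F.d))).val : ℕ) : ZMod 7) ^ 5 ∧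
        ∀ x : AlgebraicClosure ℚ, x ∈ F.layer n →
          ((υ : absoluteGaloisGroup ℚ) * F.γ₀ ^ F.r n ((g : ZMod (7 ^ (n + 1) * F.d))).val) • x =
            ((absoluteGaloisGroup.toAlgEquiv ℚ).symm (σ g)) • x := by
    intro g
    obtain ⟨υ, hη, -, hlvl⟩ :=
      F.exists_towerLift (Nat.Coprime.mul_right (F.val_coprime_seven n g) (F.val_coprime_d n g))
    exact ⟨υ, hη, (hlvl n).2 _ (by rw [toAlgEquiv_symm_smul]; exact hσ g)⟩
  choose υ hυη hυσ using hlift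
  have h1m : 1 ≤ 7 ^ (n + 1) * F.d := (F.one_lt_level n).le
  have hcpow : ((absoluteGaloisGroup.toAlgEquiv ℚ).symm c) • F.ζsys n = F.ζsys n ^ (7 ^ (n + 1) * F.d - 1) := by
    rw [toAlgEquiv_symm_smul, hcζ]
    refine inv_eq_of_mul_eq_one_right ?_
    rw [← pow_succ', Nat.sub_add_cancel h1m]
    exact (F.isPrimitiveRoot_ζsys n).pow_eq_one
  obtain ⟨υc, hυcη, -, hυcl⟩ := F.exists_towerLift (F.level_sub_one_coprime n)
  have hυcσ := (hυcl n).2 _ hcpow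
  have hυc1 : ((F.η₁ υc : ℤ_[7]ˣ) : ℤ_[7]) = 1 := by rw [hυcη, F.reading_level_sub_one]
  -- Steps B–C: the push dies at level `n`; Step D: apply `e_{η₁}`
  have hker := F.rep_chiProjector_eq_one he (F.rep_pushedTwistedUnit_eq_one d n c σ T hT Y hcore υ hυσ υc hυcσ)
  rw [map_add d.e, F.apply_act_one_add_X_pow_smul_of_eq he hυc1 (F.r n (7 ^ (n + 1) * F.d - 1)),
    F.apply_pushedElement_eq d n Y υ hυη R hR] at hker
  -- `(1 + (1+T)^{r_n(mₙ−1)})·48 ≡ 96`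
  have hsub : ((48 : ℕ) : IwasawaAlgebra 7) +
      C (1 : ℤ_[7]) * (1 + X : IwasawaAlgebra 7) ^ F.r n (7 ^ (n + 1) * F.d - 1) * ((48 : ℕ) : IwasawaAlgebra 7) -
      C ((96 : ℕ) : ℤ_[7]) ∈ Ideal.span {layerModulus 7 n} := by
    have e1 : ((48 : ℕ) : IwasawaAlgebra 7) +
        C (1 : ℤ_[7]) * (1 + X : IwasawaAlgebra 7) ^ F.r n (7 ^ (n + 1) * F.d - 1) * ((48 : ℕ) : IwasawaAlgebra 7) -
        C ((96 : ℕ) : ℤ_[7]) = ((1 + X : IwasawaAlgebra 7) ^ F.r n (7 ^ (n + 1) * F.d - 1) - 1) * 48 := by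
      rw [map_one C, one_mul, map_natCast C 96]; norm_num; ring
    rw [e1]
    exact Ideal.mul_mem_right _ _ (F.one_add_X_pow_r_level_sub_one_sub_one_mem n)
  rw [smul_smul, ← add_smul, F.rep_smul_eq_rep_smul_of_sub_mem n hsub] at hker
  -- Step E: strip the unit `96`
  obtain ⟨w, hw⟩ := isUnit_ninetySix
  have hw1 : C ((w⁻¹ : ℤ_[7]ˣ) : ℤ_[7]) * C ((96 : ℕ) : ℤ_[7]) = (1 : IwasawaAlgebra 7) := by
    rw [← hw, ← map_mul C, Units.inv_mul, map_one C]
  have h3 := F.rep_smul_eq_one hker (C ((w⁻¹ : ℤ_[7]ˣ) : ℤ_[7]))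
  rwa [smul_smul, hw1, one_smul] at h3

/-- **The torsor's reading is level-independent**: `χ_D(b̄ₙ)ω(b̄ₙ)⁵ = χ_D(b̄₀)ω(b̄₀)⁵` for the compatible coordinates `b` of ONE
complex embedding (`b_{n+1} ≡ b_n (mod mₙ)`, `torsor_val_modEq`). [cite: Lang1990, Ch. 10 §1 (PDF p. 167)] [cite: Tsuji1999, §6 (p. 20)] -/
theorem reading_torsor_eq {Φ : AlgebraicClosure ℚ →+* ℂ} {b : ∀ n : ℕ, (ZMod (7 ^ (n + 1) * F.d))ˣ}
    (hb : ∀ n : ℕ, Φ (F.ζsys n) =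
      Complex.exp (2 * Real.pi * Complex.I / (7 ^ (n + 1) * F.d : ℕ)) ^ ((b n : ZMod (7 ^ (n + 1) * F.d))).val) (n : ℕ) :
    F.χD ((((b n : ZMod (7 ^ (n + 1) * F.d))).val : ℕ) : ZMod F.d) *
        F.ω ((((b n : ZMod (7 ^ (n + 1) * F.d))).val : ℕ) : ZMod 7) ^ 5 =
      F.χD ((((b 0 : ZMod (7 ^ (0 + 1) * F.d))).val : ℕ) : ZMod F.d) *
        F.ω ((((b 0 : ZMod (7 ^ (0 + 1) * F.d))).val : ℕ) : ZMod 7) ^ 5 := by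
  induction n with
  | zero => rfl
  | succ n ih =>
    have h := F.torsor_val_modEq hb n
    have hd : ((((b (n + 1) : ZMod (7 ^ (n + 1 + 1) * F.d))).val : ℕ) : ZMod F.d) =
        ((((b n : ZMod (7 ^ (n + 1) * F.d))).val : ℕ) : ZMod F.d) :=
      (ZMod.natCast_eq_natCast_iff _ _ _).mpr (h.of_dvd (Dvd.intro_left _ rfl))
    have h7 : ((((b (n + 1) : ZMod (7 ^ (n + 1 + 1) * F.d))).val : ℕ) : ZMod 7) =
        ((((b n : ZMod (7 ^ (n + 1) * F.d))).val : ℕ) : ZMod 7) :=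
      (ZMod.natCast_eq_natCast_iff _ _ _).mpr (h.of_dvd ((dvd_pow_self 7 (Nat.succ_ne_zero n)).mul_right _))
    rw [hd, h7, ih]

end GenusFrame

/-! ## §3 ★★★ The identity up to a `Λ`-unit on the pin -/

section Assembly

/-- ★★★ **THE IDENTITY UP TO A `Λ`-UNIT ON THE PIN** (K1ᵘ's conjunct (5)-unit, CONDITIONAL on F5): for every `𝒞₇`-genus frame `F`
and every value-pinned elliptic family `θu` (`IsNormedEllipticUnitFamily F θu`), EVERY oriented genus datum `d` over `(F, θu)`
satisfies `e_{η₁}θ^𝔞 = (w·G_𝔞)•e_{η₁}ξ` for some `w ∈ Λˣ` (`d.UnitFactorisationShape`).  Assembly: (A6-2) `exists_twistedGenusUnit_eq_one`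
(`Φ, c, b, W(b), σ, T` and the core identity at every level), §2 at every level, E3b at every level with `d.x_spec n`,
`d.Θm_spec n`, `W′ = C(χ_D(b̄₀)ω(b̄₀)⁵)·W ≡ R_n(b̄ₙ)`, so `rep n (2•e_{η₁}θ + (W′⁻¹·x·Θm)•e_{η₁}ξ) = 1` for all `n`; pin (I)
`eq_zero_of_rep_eq_one`; `2 ∈ ℤ₇ˣ`: `e_{η₁}θ = (c₀·W′⁻¹·x·Θm)•e_{η₁}ξ`, `c₀ = −½`.
[cite: Kato2004Asterisque, §15.5 (15.5.1), §15.6 (pp. 253–254)] [cite: Tsuji1999, §3 (pp. 5–6), §6 (p. 20)]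
[cite: Lang1990, Ch. 10 §1 Thm 1.2, §2 (2)–(3) (PDF pp. 167–171)] [cite: Washington1997, §6.2, §7.2 Thm 7.10] -/
theorem unitSideIdentityShapeUpToUnit_of_pin (hF5 : Kato2004.kato1551_kroneckerLimitFormula) (F : GenusFrame)
    {θu : ∀ n : ℕ, globalUnitsOf (F.layer n)} (hθu : IsNormedEllipticUnitFamily F θu) :
    UnitSideIdentityShapeUpToUnit F θu := by
  intro d
  haveI : Fact (Nat.Prime 7) := ⟨Nat.prime_seven⟩
  haveI : NeZero (7 : ℕ) := ⟨by norm_num⟩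
  haveI hne : ∀ n : ℕ, NeZero (7 ^ (n + 1) * F.d) := fun n => ⟨(Nat.lt_trans zero_lt_one (F.one_lt_level n)).ne'⟩
  -- (A6-2): the embedding, the conjugation, the torsor, `W(b)`, the transports and the core identity at every level
  obtain ⟨Φ, c, b, W, σ, T, hΦc, hb, hW, hσ, hT, -, hcore⟩ :=
    exists_twistedGenusUnit_eq_one hF5 F hθu d.ξu d.ξu_val 1
  -- `(N𝔞/7) = 1`
  have hK : J((F.normA : ℤ) | 7) = 1 := by
    have h := F.jacobiChar_normA_eq_one hθu
    rw [jacobiChar_natCast] at h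
    exact_mod_cast h
  -- the torsor's reading `ρ₀ = χ_D(b̄₀)ω(b̄₀)⁵ ∈ ℤ₇ˣ` and `W′ = C ρ₀ · W`
  have hρu : IsUnit (F.χD ((((b 0 : ZMod (7 ^ (0 + 1) * F.d))).val : ℕ) : ZMod F.d) *
      F.ω ((((b 0 : ZMod (7 ^ (0 + 1) * F.d))).val : ℕ) : ZMod 7) ^ 5) := by
    refine IsUnit.mul ?_ ((isUnit_apply_natCast_of_coprime F.ω (F.val_coprime_seven 0 (b 0))).pow 5)
    have hu : IsUnit (((((b 0 : ZMod (7 ^ (0 + 1) * F.d))).val : ℕ)) : ZMod F.d) := by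
      rw [← ZMod.coe_unitOfCoprime _ (F.val_coprime_d 0 (b 0))]; exact Units.isUnit _
    exact hu.map F.χD
  obtain ⟨ρ, hρ⟩ := hρu
  obtain ⟨W', hW'⟩ : ∃ W' : (IwasawaAlgebra 7)ˣ, (W' : IwasawaAlgebra 7) = C (ρ : ℤ_[7]) * W :=
    ⟨Units.map (C : ℤ_[7] →+* IwasawaAlgebra 7).toMonoidHom ρ * W, rfl⟩
  -- every level: `rep n (2•θ + (W′⁻¹·x·Θm)•ξ) = 1`
  have hlev : ∀ n : ℕ, F.U.rep n ((2 : IwasawaAlgebra 7) • (d.θ : F.U.M) +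
      (((W'⁻¹ : (IwasawaAlgebra 7)ˣ) : IwasawaAlgebra 7) * d.x * d.Θm) • (d.ξ : F.U.M)) = 1 := by
    intro n
    have hcζ : c (F.ζsys n) = (F.ζsys n)⁻¹ :=
      complexConjugation_apply_of_pow_eq_one hΦc (NeZero.ne _) (F.isPrimitiveRoot_ζsys n).pow_eq_one
    obtain ⟨R, hR⟩ : ∃ R : ℕ → IwasawaAlgebra 7,
        ∀ a : ℕ, R a = C (F.χD (a : ZMod F.d) * F.ω (a : ZMod 7) ^ 5) * (1 + X) ^ F.r n a := ⟨_, fun a => rfl⟩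
    -- §2 at level `n`
    have hK1 := F.rep_two_smul_theta_add_smul_xi_eq_one d.toGenusDatum n hcζ (σ n) (T n) (hσ n) (hT n)
      (fun g => J(((((b n * g)⁻¹ : (ZMod (7 ^ (n + 1) * F.d))ˣ) : ZMod (7 ^ (n + 1) * F.d)).val : ℤ) | 7) *
        ((F.normA * (((b n * g)⁻¹ : (ZMod (7 ^ (n + 1) * F.d))ˣ) : ZMod (7 ^ (n + 1) * F.d)).val /
          (7 ^ (n + 1) * F.d) : ℕ) : ℤ)) (hcore n).1 R hR
    -- E3b at level `n`
    have hE3 := F.twistExponentSum_mul_reading_sub_mem n (b n)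
      (fun g => J(((((b n * g)⁻¹ : (ZMod (7 ^ (n + 1) * F.d))ˣ) : ZMod (7 ^ (n + 1) * F.d)).val : ℤ) | 7) *
        ((F.normA * (((b n * g)⁻¹ : (ZMod (7 ^ (n + 1) * F.d))ˣ) : ZMod (7 ^ (n + 1) * F.d)).val /
          (7 ^ (n + 1) * F.d) : ℕ) : ℤ)) (fun g => rfl) hK R hR (d.x_spec n) (d.Θm_spec n)
    -- `R_n(b̄ₙ) ≡ W′ (mod h_n)`
    have hRW : R ((b n : ZMod (7 ^ (n + 1) * F.d))).val - (W' : IwasawaAlgebra 7) ∈ Ideal.span {layerModulus 7 n} := by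
      have e : R ((b n : ZMod (7 ^ (n + 1) * F.d))).val - (W' : IwasawaAlgebra 7) =
          -(C (ρ : ℤ_[7]) * ((W : IwasawaAlgebra 7) - C ((1 : ℤ_[7]ˣ) : ℤ_[7]) *
            (1 + X) ^ F.r n ((b n : ZMod (7 ^ (n + 1) * F.d))).val)) := by
        rw [hR, F.reading_torsor_eq hb n, ← hρ, hW', Units.val_one, map_one]; ring
      rw [e, Ideal.neg_mem_iff]
      exact Ideal.mul_mem_left _ _ (hW n)
    -- hence `Pₙ ≡ W′⁻¹·x·Θm`
    have hP : (∑ g : (ZMod (7 ^ (n + 1) * F.d))ˣ,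
        C (((J(((((b n * g)⁻¹ : (ZMod (7 ^ (n + 1) * F.d))ˣ) : ZMod (7 ^ (n + 1) * F.d)).val : ℤ) | 7) *
          ((F.normA * (((b n * g)⁻¹ : (ZMod (7 ^ (n + 1) * F.d))ˣ) : ZMod (7 ^ (n + 1) * F.d)).val /
            (7 ^ (n + 1) * F.d) : ℕ) : ℤ) : ℤ) : ℤ_[7])) * R ((g : ZMod (7 ^ (n + 1) * F.d))).val) -
        ((W'⁻¹ : (IwasawaAlgebra 7)ˣ) : IwasawaAlgebra 7) * d.x * d.Θm ∈ Ideal.span {layerModulus 7 n} := by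
      rw [← Ideal.unit_mul_mem_iff_mem _ (Units.isUnit W')]
      have e : (W' : IwasawaAlgebra 7) * ((∑ g : (ZMod (7 ^ (n + 1) * F.d))ˣ,
          C (((J(((((b n * g)⁻¹ : (ZMod (7 ^ (n + 1) * F.d))ˣ) : ZMod (7 ^ (n + 1) * F.d)).val : ℤ) | 7) *
            ((F.normA * (((b n * g)⁻¹ : (ZMod (7 ^ (n + 1) * F.d))ˣ) : ZMod (7 ^ (n + 1) * F.d)).val /
              (7 ^ (n + 1) * F.d) : ℕ) : ℤ) : ℤ) : ℤ_[7])) * R ((g : ZMod (7 ^ (n + 1) * F.d))).val) -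
          ((W'⁻¹ : (IwasawaAlgebra 7)ˣ) : IwasawaAlgebra 7) * d.x * d.Θm) =
          ((∑ g : (ZMod (7 ^ (n + 1) * F.d))ˣ,
            C (((J(((((b n * g)⁻¹ : (ZMod (7 ^ (n + 1) * F.d))ˣ) : ZMod (7 ^ (n + 1) * F.d)).val : ℤ) | 7) *
              ((F.normA * (((b n * g)⁻¹ : (ZMod (7 ^ (n + 1) * F.d))ˣ) : ZMod (7 ^ (n + 1) * F.d)).val /
                (7 ^ (n + 1) * F.d) : ℕ) : ℤ) : ℤ) : ℤ_[7])) * R ((g : ZMod (7 ^ (n + 1) * F.d))).val) *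
              R ((b n : ZMod (7 ^ (n + 1) * F.d))).val - d.x * d.Θm) -
          (∑ g : (ZMod (7 ^ (n + 1) * F.d))ˣ,
            C (((J(((((b n * g)⁻¹ : (ZMod (7 ^ (n + 1) * F.d))ˣ) : ZMod (7 ^ (n + 1) * F.d)).val : ℤ) | 7) *
              ((F.normA * (((b n * g)⁻¹ : (ZMod (7 ^ (n + 1) * F.d))ˣ) : ZMod (7 ^ (n + 1) * F.d)).val /
                (7 ^ (n + 1) * F.d) : ℕ) : ℤ) : ℤ) : ℤ_[7])) * R ((g : ZMod (7 ^ (n + 1) * F.d))).val) *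
            (R ((b n : ZMod (7 ^ (n + 1) * F.d))).val - (W' : IwasawaAlgebra 7)) := by
        have h1 : (W' : IwasawaAlgebra 7) * ((W'⁻¹ : (IwasawaAlgebra 7)ˣ) : IwasawaAlgebra 7) = 1 := Units.mul_inv W'
        calc _ = (W' : IwasawaAlgebra 7) * (∑ g : (ZMod (7 ^ (n + 1) * F.d))ˣ,
              C (((J(((((b n * g)⁻¹ : (ZMod (7 ^ (n + 1) * F.d))ˣ) : ZMod (7 ^ (n + 1) * F.d)).val : ℤ) | 7) *
                ((F.normA * (((b n * g)⁻¹ : (ZMod (7 ^ (n + 1) * F.d))ˣ) : ZMod (7 ^ (n + 1) * F.d)).val /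
                  (7 ^ (n + 1) * F.d) : ℕ) : ℤ) : ℤ) : ℤ_[7])) * R ((g : ZMod (7 ^ (n + 1) * F.d))).val) -
              ((W' : IwasawaAlgebra 7) * ((W'⁻¹ : (IwasawaAlgebra 7)ˣ) : IwasawaAlgebra 7)) * d.x * d.Θm := by ring
          _ = _ := by rw [h1]; ring
      rw [e]
      exact Ideal.sub_mem _ hE3 (Ideal.mul_mem_left _ _ hRW)
    rw [F.U.rep_add, ← F.rep_smul_eq_rep_smul_of_sub_mem n hP, ← F.U.rep_add]
    exact hK1
  -- pin (I): the element of `𝓤` with trivial projections vanishes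
  have hzero := F.U.eq_zero_of_rep_eq_one _ hlev
  -- solve for `e_{η₁}θ`: `2 ∈ ℤ₇ˣ`, `c₀ = −½`
  have hθM : (d.θ : F.U.M) = (C GenusDatum.cZero * ((W'⁻¹ : (IwasawaAlgebra 7)ˣ) : IwasawaAlgebra 7) * d.x * d.Θm) •
      (d.ξ : F.U.M) := by
    have h2 : (2 : IwasawaAlgebra 7) • (d.θ : F.U.M) =
        -((((W'⁻¹ : (IwasawaAlgebra 7)ˣ) : IwasawaAlgebra 7) * d.x * d.Θm) • (d.ξ : F.U.M)) :=
      eq_neg_of_add_eq_zero_left hzero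
    have hhalf : C (Ring.inverse (2 : ℤ_[7])) * (2 : IwasawaAlgebra 7) = 1 := by
      rw [show (2 : IwasawaAlgebra 7) = C (2 : ℤ_[7]) from (map_ofNat C 2).symm, ← map_mul, Ring.inverse_mul_cancel _
        GenusDatum.isUnit_two, map_one]
    calc (d.θ : F.U.M) = (C (Ring.inverse (2 : ℤ_[7])) * (2 : IwasawaAlgebra 7)) • (d.θ : F.U.M) := by rw [hhalf, one_smul]
      _ = C (Ring.inverse (2 : ℤ_[7])) • -((((W'⁻¹ : (IwasawaAlgebra 7)ˣ) : IwasawaAlgebra 7) * d.x * d.Θm) •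
            (d.ξ : F.U.M)) := by rw [← smul_smul, h2]
      _ = _ := by
          rw [smul_neg, ← neg_smul, smul_smul, GenusDatum.cZero, map_neg]
          congr 1
          ring
  rw [d.unitFactorisationShape_iff_exists_unit]
  obtain ⟨c₀, hc₀⟩ := (GenusDatum.isUnit_cZero).map (C : ℤ_[7] →+* IwasawaAlgebra 7)
  refine ⟨c₀ * W'⁻¹, Subtype.ext ?_⟩
  rw [Submodule.coe_smul, Units.val_mul, hc₀]
  exact hθM

end Assembly

end Summit.BirchSwinnertonDyer.Rank1Residual.Additive.GenusSeven

/-! ## §4 ★★★★ The K1ᵘ input stub's letter, conditional on the four facts -/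

namespace Summit.BirchSwinnertonDyer.Rank1Residual.Additive

/-- ★★★★ **THE K1ᵘ INPUT STUB'S LETTER FROM THE FACTS** (zp v15 `stub_genusUnitSideInputsSeven`, l.528–535, VERBATIM conclusion):
for every `𝒞₇`-genus frame and value-pinned elliptic family — (4a) principal / norm-coherent 12-th powers of `θu`, (4b) the same
and the SPAN shape for every Sinnott family, and (5)-unit the identity up to `Λˣ` — from F5 (Kato's (15.5.1), Kronecker's limit
formula, first binder), Tsuji's Lemma 6.2 (a), de Shalit II.2.5 (i) and II.2.4 (i) (`genusUnitSideInputsSevenUpToUnit_of_identity`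
fed with ★★★ `unitSideIdentityShapeUpToUnit_of_pin`).  CONDITIONAL on the four cited facts; nothing else asserted.
[cite: Kato2004Asterisque, §15.5 (15.5.1), §15.6 (pp. 253–254)] [cite: Tsuji1999, §3 Thm 3.1 (p. 6), §6 Lemma 6.2 (a) (p. 21)]
[cite: deShalit1987, II.2.4 (i), II.2.5 (i), II.5.1] [cite: Lang1990, Ch. 10 §1 Thm 1.2, §2 Thm 2.3 (PDF pp. 167–172)] -/
theorem genusUnitSideInputsSeven_of_facts (hF5 : Kato2004.kato1551_kroneckerLimitFormula)
    (hT : tsuji1999_lemma62a_cycChiGenerator) (h25 : DeShalit1987.prop25_i_normRelation)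
    (h24i : DeShalit1987.prop24_i_mem_rayClassField) :
    ∀ (F : GenusSeven.GenusFrame) (θu : ∀ n : ℕ, globalUnitsOf (F.layer n)), GenusSeven.IsNormedEllipticUnitFamily F θu →
      (F.IsPrincipalPowFamily θu ∧ F.IsNormCoherentPowFamily θu) ∧
        (∀ ξu : ∀ n : ℕ, globalUnitsOf (F.layer n),
          (∀ n : ℕ, (((ξu n : globalUnitsOf (F.layer n)) : (AlgebraicClosure ℚ)ˣ) : AlgebraicClosure ℚ) =
              CyclotomicUnits.sinnottNorm (t := 7 ^ (n + 1) * F.d) (F.layer n) (F.ζsys n) 1) →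
            (F.IsPrincipalPowFamily ξu ∧ F.IsNormCoherentPowFamily ξu) ∧ GenusSeven.SinnottSpanShape F ξu) ∧
        GenusSeven.UnitSideIdentityShapeUpToUnit F θu :=
  GenusSeven.genusUnitSideInputsSevenUpToUnit_of_identity hT h25 h24i
    (fun F _ hθu => GenusSeven.unitSideIdentityShapeUpToUnit_of_pin hF5 F hθu)

end Summit.BirchSwinnertonDyer.Rank1Residual.Additive

end
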